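import Mathlib.LinearAlgebra.Matrix.PosDef
import Mathlib.LinearAlgebra.Matrix.ConjTranspose
import Mathlib.Analysis.SpecialFunctions.Log.Basic
import Mathlib.Algebra.MvPolynomial.Eval
import Mathlib.LinearAlgebra.AffineSpace.AffineMap
import Mathlib.LinearAlgebra.Pi
import Mathlib.LinearAlgebra.Prod
import HarnessLib

/-!
# Lifts of convex sets by products of exponential cones and a semidefinite cone

A *`K`-lift* (lifted, or extended, conic representation) of a set `C ⊆ E` by a closed convex
cone `K` presents `C` as the shadow of an affine slice of `K`.  Gouveia–Parrilo–Thomas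
[GPT13, Def. 2.1] write this as `C = π (K ∩ L)` with `L` an affine subspace and `π` linear;
Ben-Tal–Nemirovski write the same notion as a *conic representation*
`C = {x | ∃ u, P x + Q u + p ∈ K}` ([BTN01, Lect. 2–4]; [BEN09, §1.3.3 eq. (1.3.10)]), which is
the form used here (for finite-dimensional `E` the two presentations are interchangeable up
to bookkeeping: the graph of `(x,u) ↦ P x + Q u + p` is an affine subspace, and conversely the
constraints `w ∈ L`, `π w = x` are linear equations, i.e. faces `(0, s, 0) ∈ K_exp`).

We fix the cone family relevant for *free-energy lifts* (route `FreeEnergyLift` of the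
Valiant summit): `K = K_exp ^ k × S^m_+`, the product of `k` exponential cones and one
positive-semidefinite cone of order `m`, realised concretely on
`LiftSpace k m = (Fin k → ℝ × ℝ × ℝ) × Matrix (Fin m) (Fin m) ℝ`.

## Main definitions

* `expCone : Set (ℝ × ℝ × ℝ)` — the closed exponential cone
  `{(x,y,z) | y > 0, y·exp(x/y) ≤ z} ∪ {(x,0,z) | x ≤ 0 ≤ z}`.
* `expPsdCone k m : Set (LiftSpace k m)` — `K_exp^k × S^m_+`.
* `HasExpPsdLift C k m` — `C = {x | ∃ y : Fin p → ℝ, A (x, y) + b ∈ expPsdCone k m}` for some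
  number `p` of free lifting variables, a linear map `A` and an offset `b`.
* `freeEnergy f u = log f(e^u)` for a real multivariate polynomial `f`, and its epigraph
  `freeEnergyEpigraph f`.

## Main statements (API)

* `hasExpPsdLift_iff`, `hasExpPsdLift_iff_prod`, `hasExpPsdLift_zero_iff` — unfoldings to the
  pointwise "`x ∈ C ↔ ∃ y, …`" form inlined in the route items (the last one drops the empty
  psd block when `m = 0`).
* `HasExpPsdLift.mono` — monotone in `(k, m)` (pad with the trivial cone point `0 ∈ K_exp` and a
  zero-extended psd block).
* `HasExpPsdLift.comap` — preimages under affine maps; `hasExpPsdLift_univ`,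
  `hasExpPsdLift_empty`, `hasExpPsdLift_halfSpace`, `hasExpPsdLift_hyperplane` — the LP units
  `(0, s, s) ∈ K_exp ↔ 0 ≤ s` and `(0, s, 0) ∈ K_exp ↔ s = 0`.

Intersections, products, coordinate projections, linear images, convexity and the
log-sum-exp / free-energy lifts are in `Literature.Analysis.Convex.ConeLiftCalculus`.

## References

* [GPT13] J. Gouveia, P. Parrilo, R. Thomas, *Lifts of convex sets and cone factorizations*,
  Math. Oper. Res. 38 (2013), Definition 2.1 (bib: GouveiaParriloThomas2013; arXiv:1111.3164).
* [WZ20] C. Wang, L. Zhi, *Lifts of non-compact convex sets and cone factorizations*,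
  J. Syst. Sci. Complex. 33 (2020), §3 (bib: WangZhi2020; arXiv:1501.00115) — same definition for
  non-compact `C`.
* [BTN01] A. Ben-Tal, A. Nemirovski, *Lectures on Modern Convex Optimization*, SIAM 2001
  (bib: BentalNemirovski2001) — `K`-representable sets and their calculus.
* [BEN09] A. Ben-Tal, L. El Ghaoui, A. Nemirovski, *Robust Optimization*, PUP 2009, §1.3.3
  eq. (1.3.10) and App. A.2.4.1 eq. (A.2.11) (bib: BentalElghaouiNemirovski2009) — conic
  (`K`-)representation `{y | ∃ u, Ay + Bu - b ∈ K}`; App. A.2.4.2: its calculus (rules (i)–(iv)).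
* The closed form of `K_exp` is the one of the conic solvers (MOSEK, SCS:
  O'Donoghue–Chu–Parikh–Boyd 2016, bib: OdonoghueEtAl2016) and of CvxLean's `expCone`
  (Bentkamp–Fernández Mir–Avigad, arXiv:2301.09347, §5).

## Design notes

* The number `p` of free lifting variables is not part of the size: only cone units are
  counted (`k + m` in the route), as in [GPT13].  W.l.o.g. `p ≤ 3k + m²`, not needed here.
* `Real.log 0 = 0` and `x / 0 = 0` are Mathlib junk values; `expCone` only evaluates `x / y`
  under `0 < y`, and `freeEnergy f u` is meaningful for `f(e^u) > 0` (e.g. nonzero `f` with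
  nonnegative coefficients), which is the only case the route uses.
-/

noncomputable section

open Matrix

namespace Literature.Analysis.Convex

/-! ## The exponential cone -/

/-- The (closed) **exponential cone**
`K_exp = {(x, y, z) | 0 < y ∧ y · exp (x / y) ≤ z} ∪ {(x, 0, z) | x ≤ 0 ∧ 0 ≤ z} ⊆ ℝ³`,
i.e. the closure of the epigraph of the perspective `(x, y) ↦ y · exp (x / y)` (`y > 0`) of the
exponential function.  Coordinates are ordered as in SCS / CvxLean (`exp x ≤ z` is
`(x, 1, z) ∈ K_exp`). [folklore] -/
def expCone : Set (ℝ × ℝ × ℝ) :=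
  {w | (0 < w.2.1 ∧ w.2.1 * Real.exp (w.1 / w.2.1) ≤ w.2.2) ∨ (w.2.1 = 0 ∧ w.1 ≤ 0 ∧ 0 ≤ w.2.2)}

/-- Unfolding of `expCone` (the literal form inlined in route `FreeEnergyLift`). [folklore] -/
theorem mem_expCone_iff {x y z : ℝ} :
    (x, y, z) ∈ expCone ↔ (0 < y ∧ y * Real.exp (x / y) ≤ z) ∨ (y = 0 ∧ x ≤ 0 ∧ 0 ≤ z) :=
  Iff.rfl

/-- On the open half `y > 0` the exponential cone is the epigraph of the perspective of `exp`.
[folklore] -/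
theorem mem_expCone_iff_of_pos {x y z : ℝ} (hy : 0 < y) :
    (x, y, z) ∈ expCone ↔ y * Real.exp (x / y) ≤ z := by
  rw [mem_expCone_iff]
  constructor
  · rintro (⟨-, h⟩ | ⟨h, -⟩)
    · exact h
    · exact absurd h hy.ne'
  · exact fun h => Or.inl ⟨hy, h⟩

/-- `(x, 1, z) ∈ K_exp ↔ exp x ≤ z`. [folklore] -/
theorem mem_expCone_one_iff {x z : ℝ} : (x, 1, z) ∈ expCone ↔ Real.exp x ≤ z := by
  rw [mem_expCone_iff_of_pos one_pos, div_one, one_mul]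

/-- The boundary slice `y = 0`: `(x, 0, z) ∈ K_exp ↔ x ≤ 0 ∧ 0 ≤ z`. [folklore] -/
theorem mem_expCone_zero_iff {x z : ℝ} : (x, 0, z) ∈ expCone ↔ x ≤ 0 ∧ 0 ≤ z := by
  rw [mem_expCone_iff]
  simp

/-- The apex: `0 ∈ K_exp`. [folklore] -/
theorem zero_mem_expCone : (0 : ℝ × ℝ × ℝ) ∈ expCone :=
  Or.inr ⟨rfl, le_rfl, le_rfl⟩

/-- **LP unit.** A linear inequality rides on a face of the exponential cone:
`(0, s, s) ∈ K_exp ↔ 0 ≤ s`. [folklore] -/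
theorem mem_expCone_nonneg_iff {s : ℝ} : ((0 : ℝ), s, s) ∈ expCone ↔ 0 ≤ s := by
  rw [mem_expCone_iff]
  constructor
  · rintro (⟨h, -⟩ | ⟨h, -, -⟩)
    · exact h.le
    · exact h.ge
  · intro h
    rcases h.lt_or_eq with h | h
    · exact Or.inl ⟨h, by rw [zero_div, Real.exp_zero, mul_one]⟩
    · exact Or.inr ⟨h.symm, le_rfl, h.symm ▸ le_rfl⟩

/-- **Equation unit.** A linear equation rides on a face of the exponential cone:
`(0, s, 0) ∈ K_exp ↔ s = 0`. [folklore] -/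
theorem mem_expCone_eq_iff {s : ℝ} : ((0 : ℝ), s, (0 : ℝ)) ∈ expCone ↔ s = 0 := by
  rw [mem_expCone_iff]
  constructor
  · rintro (⟨h, h'⟩ | ⟨h, -, -⟩)
    · rw [zero_div, Real.exp_zero, mul_one] at h'
      exact absurd h' (not_le.mpr h)
    · exact h
  · rintro rfl
    exact Or.inr ⟨rfl, le_rfl, le_rfl⟩

/-- Points of the exponential cone have nonnegative second and third coordinates. [folklore] -/
theorem nonneg_of_mem_expCone {w : ℝ × ℝ × ℝ} (h : w ∈ expCone) : 0 ≤ w.2.1 ∧ 0 ≤ w.2.2 := by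
  rcases h with ⟨hy, hz⟩ | ⟨hy, -, hz⟩
  · exact ⟨hy.le, (mul_pos hy (Real.exp_pos _)).le.trans hz⟩
  · exact ⟨hy.ge, hz⟩

/-- `K_exp` is a cone: closed under nonnegative scaling. [folklore] -/
theorem smul_mem_expCone {w : ℝ × ℝ × ℝ} (h : w ∈ expCone) {c : ℝ} (hc : 0 ≤ c) :
    c • w ∈ expCone := by
  obtain ⟨x, y, z⟩ := w
  rcases hc.lt_or_eq with hc | rfl
  · rcases h with ⟨hy, hz⟩ | ⟨hy, hx, hz⟩
    · refine Or.inl ⟨mul_pos hc hy, ?_⟩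
      simp only [Prod.smul_mk, smul_eq_mul]
      rw [mul_div_mul_left _ _ hc.ne', mul_assoc]
      exact mul_le_mul_of_nonneg_left hz hc.le
    · simp only at hy hx hz
      refine Or.inr ⟨?_, ?_, ?_⟩ <;> simp only [Prod.smul_mk, smul_eq_mul, hy, mul_zero]
      · exact mul_nonpos_of_nonneg_of_nonpos hc.le hx
      · exact mul_nonneg hc.le hz
  · rw [zero_smul]
    exact zero_mem_expCone

/-! ## The cone `K_exp^k × S^m_+` and lifts -/

/-- The ambient coordinate space of `K_exp^k × S^m_+`: `k` triples and one `m × m` real matrix.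
[folklore] -/
abbrev LiftSpace (k m : ℕ) : Type := (Fin k → ℝ × ℝ × ℝ) × Matrix (Fin m) (Fin m) ℝ

/-- The closed convex cone `K_exp^k × S^m_+ ⊆ LiftSpace k m`: every triple lies in the exponential
cone and the matrix block is positive semidefinite (`Matrix.PosSemidef`, i.e. symmetric with
nonnegative quadratic form). [folklore] -/
def expPsdCone (k m : ℕ) : Set (LiftSpace k m) :=
  {w | (∀ i, w.1 i ∈ expCone) ∧ w.2.PosSemidef}

/-- Unfolding of `expPsdCone`. [folklore] -/
theorem mem_expPsdCone_iff {k m : ℕ} {w : LiftSpace k m} :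
    w ∈ expPsdCone k m ↔ (∀ i, w.1 i ∈ expCone) ∧ w.2.PosSemidef :=
  Iff.rfl

/-- `0 ∈ K_exp^k × S^m_+`. [folklore] -/
theorem zero_mem_expPsdCone (k m : ℕ) : (0 : LiftSpace k m) ∈ expPsdCone k m :=
  ⟨fun _ => zero_mem_expCone, Matrix.PosSemidef.zero⟩

/-- A `0 × 0` real matrix is positive semidefinite (the psd block is vacuous when `m = 0`).
[folklore] -/
theorem posSemidef_fin_zero (M : Matrix (Fin 0) (Fin 0) ℝ) : M.PosSemidef := by
  rw [Subsingleton.elim M 0]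
  exact Matrix.PosSemidef.zero

variable {E : Type*} [AddCommGroup E] [Module ℝ E]

/-- **`K_exp^k × S^m_+`-lift of a set** (Gouveia–Parrilo–Thomas `K`-lift, in the conic-inequality
form of Ben-Tal–Nemirovski): `C ⊆ E` has an exp+psd lift with `k` exponential cones and one psd
cone of order `m` if, for some number `p` of free lifting variables, some `ℝ`-linear map
`A : E × ℝ^p → LiftSpace k m` and offset `b`,
`C = {x | ∃ y, A (x, y) + b ∈ K_exp^k × S^m_+}`.
Linear (in)equalities are not separate units: they ride on faces of `K_exp`
(`mem_expCone_nonneg_iff`, `mem_expCone_eq_iff`).  The *size* of the lift is `k + m`.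
BOOKKEEPING differs from [GPT13, Def. 2.1] (`C = π (K ∩ L)`): free lifting variables and linear
(in)equalities are not counted here (`hasExpPsdLift_univ : HasExpPsdLift univ 0 0`); for
finite-dimensional `E` the GPT form needs at most `dim E` more exponential cones and the same
psd order (`HasExpPsdLift.hasExpPsdProjLift` in `ConeLiftCalculus`), so a lower bound on GPT lift
size from the literature constrains `k + dim E`, not `k`.
[cite: GouveiaParriloThomas2013, Def. 2.1] -/
def HasExpPsdLift (C : Set E) (k m : ℕ) : Prop :=
  ∃ (p : ℕ) (A : E × (Fin p → ℝ) →ₗ[ℝ] LiftSpace k m) (b : LiftSpace k m),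
    C = {x | ∃ y : Fin p → ℝ, A (x, y) + b ∈ expPsdCone k m}

/-- Pointwise unfolding of `HasExpPsdLift`: the literal shape
`∀ x, x ∈ C ↔ ∃ y, (∀ i, (A (x, y) + b).1 i ∈ K_exp) ∧ (A (x, y) + b).2.PosSemidef`
inlined in the items of route `FreeEnergyLift`. [folklore] -/
theorem hasExpPsdLift_iff {C : Set E} {k m : ℕ} :
    HasExpPsdLift C k m ↔
      ∃ (p : ℕ) (A : E × (Fin p → ℝ) →ₗ[ℝ] LiftSpace k m) (b : LiftSpace k m),
        ∀ x, x ∈ C ↔ ∃ y : Fin p → ℝ,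
          (∀ i, (A (x, y) + b).1 i ∈ expCone) ∧ (A (x, y) + b).2.PosSemidef := by
  simp only [HasExpPsdLift, Set.ext_iff, Set.mem_setOf_eq, mem_expPsdCone_iff]

/-- Pointwise unfolding of `HasExpPsdLift` for subsets of a product (epigraphs
`{(u, t) | φ u ≤ t}`), with the two coordinates bound separately. [folklore] -/
theorem hasExpPsdLift_iff_prod {F : Type*} [AddCommGroup F] [Module ℝ F] {C : Set (E × F)}
    {k m : ℕ} :
    HasExpPsdLift C k m ↔
      ∃ (p : ℕ) (A : (E × F) × (Fin p → ℝ) →ₗ[ℝ] LiftSpace k m) (b : LiftSpace k m),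
        ∀ x z, (x, z) ∈ C ↔ ∃ y : Fin p → ℝ,
          (∀ i, (A ((x, z), y) + b).1 i ∈ expCone) ∧ (A ((x, z), y) + b).2.PosSemidef := by
  rw [hasExpPsdLift_iff]
  simp only [Prod.forall]

/-- With no psd block (`m = 0`) a lift is a lift by `k` exponential cones alone (an exact
*geometric program* in conic form); this is the shape inlined in items `MonotoneToLift` and
`PermanentExpConeLowerBound`. [folklore] -/
theorem hasExpPsdLift_zero_iff {C : Set E} {k : ℕ} :
    HasExpPsdLift C k 0 ↔
      ∃ (p : ℕ) (A : E × (Fin p → ℝ) →ₗ[ℝ] (Fin k → ℝ × ℝ × ℝ)) (b : Fin k → ℝ × ℝ × ℝ),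
        ∀ x, x ∈ C ↔ ∃ y : Fin p → ℝ, ∀ i, (A (x, y) + b) i ∈ expCone := by
  rw [hasExpPsdLift_iff]
  constructor
  · rintro ⟨p, A, b, h⟩
    refine ⟨p, (LinearMap.fst ℝ _ _).comp A, b.1, fun x => ?_⟩
    rw [h]
    simp [posSemidef_fin_zero]
  · rintro ⟨p, A, b, h⟩
    refine ⟨p, A.prod 0, (b, 0), fun x => ?_⟩
    rw [h]
    simp [posSemidef_fin_zero]

/-! ## Padding: monotonicity in `(k, m)` -/

section padding

variable (V : Type*) [AddCommGroup V] [Module ℝ V]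

/-- Extension by zero of a `Fin k`-indexed family to a `Fin k'`-indexed one (entries `≥ k`, and
entries lost when `k' < k`, are dropped/zero). [folklore] -/
def padFin (k k' : ℕ) : (Fin k → V) →ₗ[ℝ] (Fin k' → V) where
  toFun w i := if h : (i : ℕ) < k then w ⟨i, h⟩ else 0
  map_add' w w' := by
    funext i
    dsimp only [Pi.add_apply]
    split_ifs <;> simp
  map_smul' c w := by
    funext i
    dsimp only [Pi.smul_apply, RingHom.id_apply]
    split_ifs <;> simp

variable {V}

/-- Entries of `padFin`. [folklore] -/
theorem padFin_apply {k k' : ℕ} (w : Fin k → V) (i : Fin k') :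
    padFin V k k' w i = if h : (i : ℕ) < k then w ⟨i, h⟩ else 0 :=
  rfl

/-- For `k ≤ k'`, all entries of the zero-extension lie in a set containing `0` iff all original
entries do. [folklore] -/
theorem forall_padFin_mem_iff {k k' : ℕ} (hk : k ≤ k') {S : Set V} (h0 : (0 : V) ∈ S)
    (w : Fin k → V) : (∀ i : Fin k', padFin V k k' w i ∈ S) ↔ ∀ i : Fin k, w i ∈ S := by
  constructor
  · intro h i
    have := h ⟨i, lt_of_lt_of_le i.2 hk⟩
    rwa [padFin_apply, dif_pos i.2] at this
  · intro h i
    rw [padFin_apply]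
    split_ifs with hi
    · exact h _
    · exact h0

variable {m m' : ℕ}

/-- The `0/1` selection matrix of a map `e : Fin m → Fin m'` (`P i a = 1 ↔ i = e a`). [folklore] -/
def selMatrix (e : Fin m → Fin m') : Matrix (Fin m') (Fin m) ℝ :=
  Matrix.of fun i a => if i = e a then 1 else 0

/-- `Pᵀ P = 1` for the selection matrix of an injective map. [folklore] -/
theorem selMatrix_transpose_mul_self {e : Fin m → Fin m'} (he : Function.Injective e) :
    (selMatrix e)ᵀ * selMatrix e = 1 := by
  ext a b
  simp only [selMatrix, Matrix.mul_apply, Matrix.transpose_apply, Matrix.of_apply, ite_mul,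
    one_mul, zero_mul, Finset.sum_ite_eq', Finset.mem_univ, if_true, Matrix.one_apply, he.eq_iff]

/-- `Pᵀ Q = 0` for selection matrices of maps with disjoint ranges. [folklore] -/
theorem selMatrix_transpose_mul_of_ne {m₁ m₂ : ℕ} {e : Fin m₁ → Fin m'} {f : Fin m₂ → Fin m'}
    (h : ∀ a b, e a ≠ f b) : (selMatrix e)ᵀ * selMatrix f = 0 := by
  ext a b
  simp only [selMatrix, Matrix.mul_apply, Matrix.transpose_apply, Matrix.of_apply, ite_mul,
    one_mul, zero_mul, Finset.sum_ite_eq', Finset.mem_univ, if_true, Matrix.zero_apply, h a b,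
    if_false]

/-- Re-index a square matrix along `e : Fin m → Fin m'` and extend by zero: `M ↦ P M Pᵀ` with
`P = selMatrix e`. [folklore] -/
def padMatrix (e : Fin m → Fin m') : Matrix (Fin m) (Fin m) ℝ →ₗ[ℝ] Matrix (Fin m') (Fin m') ℝ where
  toFun M := selMatrix e * M * (selMatrix e)ᵀ
  map_add' M N := by rw [Matrix.mul_add, Matrix.add_mul]
  map_smul' c M := by
    rw [Matrix.mul_smul, Matrix.smul_mul]
    rfl

/-- Unfolding of `padMatrix`. [folklore] -/
theorem padMatrix_apply (e : Fin m → Fin m') (M : Matrix (Fin m) (Fin m) ℝ) :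
    padMatrix e M = selMatrix e * M * (selMatrix e)ᵀ :=
  rfl

/-- Congruence preserves positive semidefiniteness: `M ⪰ 0 → P M Pᵀ ⪰ 0`. [folklore] -/
theorem posSemidef_padMatrix {e : Fin m → Fin m'} {M : Matrix (Fin m) (Fin m) ℝ}
    (hM : M.PosSemidef) : (padMatrix e M).PosSemidef := by
  have := hM.mul_mul_conjTranspose_same (selMatrix e)
  rwa [Matrix.conjTranspose_eq_transpose_of_trivial] at this

/-- Recovering a block: `Pᵀ (P M Pᵀ + Q N Qᵀ) P = M` when `PᵀP = 1` and `PᵀQ = 0`. [folklore] -/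
theorem selMatrix_transpose_mul_padMatrix_add_mul {m₁ m₂ : ℕ} {e : Fin m₁ → Fin m'}
    {f : Fin m₂ → Fin m'} (he : Function.Injective e) (h : ∀ a b, e a ≠ f b)
    (M : Matrix (Fin m₁) (Fin m₁) ℝ) (N : Matrix (Fin m₂) (Fin m₂) ℝ) :
    (selMatrix e)ᵀ * (padMatrix e M + padMatrix f N) * selMatrix e = M := by
  have h1 := selMatrix_transpose_mul_self he
  have h2 := selMatrix_transpose_mul_of_ne h
  have h3 : (selMatrix f)ᵀ * selMatrix e = 0 :=
    selMatrix_transpose_mul_of_ne fun b a => (h a b).symm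
  rw [padMatrix_apply, padMatrix_apply, Matrix.mul_add, Matrix.add_mul]
  have eq1 : (selMatrix e)ᵀ * (selMatrix e * M * (selMatrix e)ᵀ) * selMatrix e = M := by
    calc (selMatrix e)ᵀ * (selMatrix e * M * (selMatrix e)ᵀ) * selMatrix e
        = ((selMatrix e)ᵀ * selMatrix e) * M * ((selMatrix e)ᵀ * selMatrix e) := by
          simp only [Matrix.mul_assoc]
      _ = M := by rw [h1, Matrix.one_mul, Matrix.mul_one]
  have eq2 : (selMatrix e)ᵀ * (selMatrix f * N * (selMatrix f)ᵀ) * selMatrix e = 0 := by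
    calc (selMatrix e)ᵀ * (selMatrix f * N * (selMatrix f)ᵀ) * selMatrix e
        = ((selMatrix e)ᵀ * selMatrix f) * N * ((selMatrix f)ᵀ * selMatrix e) := by
          simp only [Matrix.mul_assoc]
      _ = 0 := by rw [h2, Matrix.zero_mul, Matrix.zero_mul]
  rw [eq1, eq2, add_zero]

/-- Zero-extension along an injective re-indexing preserves and reflects positive
semidefiniteness. [folklore] -/
theorem posSemidef_padMatrix_iff {e : Fin m → Fin m'} (he : Function.Injective e)
    {M : Matrix (Fin m) (Fin m) ℝ} : (padMatrix e M).PosSemidef ↔ M.PosSemidef := by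
  refine ⟨fun h => ?_, posSemidef_padMatrix⟩
  have := h.conjTranspose_mul_mul_same (selMatrix e)
  rwa [Matrix.conjTranspose_eq_transpose_of_trivial, padMatrix_apply,
    show (selMatrix e)ᵀ * (selMatrix e * M * (selMatrix e)ᵀ) * selMatrix e
        = ((selMatrix e)ᵀ * selMatrix e) * M * ((selMatrix e)ᵀ * selMatrix e) by
      simp only [Matrix.mul_assoc],
    selMatrix_transpose_mul_self he, Matrix.one_mul, Matrix.mul_one] at this

/-- A sum of two zero-extended blocks with disjoint supports is psd iff both blocks are.
[folklore] -/
theorem posSemidef_padMatrix_add_iff {m₁ m₂ : ℕ} {e : Fin m₁ → Fin m'} {f : Fin m₂ → Fin m'}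
    (he : Function.Injective e) (hf : Function.Injective f) (h : ∀ a b, e a ≠ f b)
    {M : Matrix (Fin m₁) (Fin m₁) ℝ} {N : Matrix (Fin m₂) (Fin m₂) ℝ} :
    (padMatrix e M + padMatrix f N).PosSemidef ↔ M.PosSemidef ∧ N.PosSemidef := by
  refine ⟨fun hMN => ⟨?_, ?_⟩,
    fun hMN => (posSemidef_padMatrix hMN.1).add (posSemidef_padMatrix hMN.2)⟩
  · have := hMN.conjTranspose_mul_mul_same (selMatrix e)
    rwa [Matrix.conjTranspose_eq_transpose_of_trivial,
      selMatrix_transpose_mul_padMatrix_add_mul he h] at this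
  · have := hMN.conjTranspose_mul_mul_same (selMatrix f)
    rwa [Matrix.conjTranspose_eq_transpose_of_trivial, add_comm,
      selMatrix_transpose_mul_padMatrix_add_mul hf (fun a b => (h b a).symm)] at this

/-- The padding map `LiftSpace k m → LiftSpace k' m'` (`m ≤ m'`): zero-extend the triples and
the psd block. [folklore] -/
def padLift (k k' : ℕ) (hm : m ≤ m') : LiftSpace k m →ₗ[ℝ] LiftSpace k' m' :=
  (padFin (ℝ × ℝ × ℝ) k k').prodMap (padMatrix (Fin.castLE hm))

/-- Padding preserves and reflects membership in the cone (for `k ≤ k'`, `m ≤ m'`). [folklore] -/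
theorem padLift_mem_iff {k k' : ℕ} (hk : k ≤ k') (hm : m ≤ m') (w : LiftSpace k m) :
    padLift k k' hm w ∈ expPsdCone k' m' ↔ w ∈ expPsdCone k m := by
  simp only [padLift, mem_expPsdCone_iff, LinearMap.prodMap_apply]
  rw [forall_padFin_mem_iff hk zero_mem_expCone,
    posSemidef_padMatrix_iff (Fin.castLE_injective hm)]

end padding

/-- **Monotonicity.** A lift by `K_exp^k × S^m_+` is also a lift by `K_exp^k' × S^m'_+` whenever
`k ≤ k'` and `m ≤ m'` (pad with `0 ∈ K_exp` and a zero-extended psd block). [folklore] -/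
theorem HasExpPsdLift.mono {C : Set E} {k m k' m' : ℕ} (h : HasExpPsdLift C k m) (hk : k ≤ k')
    (hm : m ≤ m') : HasExpPsdLift C k' m' := by
  obtain ⟨p, A, b, rfl⟩ := h
  refine ⟨p, (padLift k k' hm).comp A, padLift k k' hm b, ?_⟩
  ext x
  simp only [Set.mem_setOf_eq, LinearMap.comp_apply, ← map_add, padLift_mem_iff hk hm]

/-! ## Affine preimages and the elementary sets -/

/-- **Affine preimages.** If `C ⊆ E` has a lift then so does `f ⁻¹' C` for every affine map
`f : E' → E`, with the same cones (substitute `f x` for `x`).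
[cite: BentalElghaouiNemirovski2009, App. A.2.4.2 rule (iii)] -/
theorem HasExpPsdLift.comap {E' : Type*} [AddCommGroup E'] [Module ℝ E'] {C : Set E} {k m : ℕ}
    (h : HasExpPsdLift C k m) (f : E' →ᵃ[ℝ] E) : HasExpPsdLift (f ⁻¹' C) k m := by
  obtain ⟨p, A, b, rfl⟩ := h
  refine ⟨p, A.comp (f.linear.prodMap LinearMap.id), A (f 0, 0) + b, ?_⟩
  ext x
  have hfx : f x = f.linear x + f 0 := by
    have := congrFun f.decomp x
    simpa using this
  simp only [Set.mem_preimage, Set.mem_setOf_eq]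
  refine exists_congr fun y => ?_
  have key : A.comp (f.linear.prodMap LinearMap.id) (x, y) + (A (f 0, 0) + b) = A (f x, y) + b := by
    rw [LinearMap.comp_apply, LinearMap.prodMap_apply, LinearMap.id_apply, ← add_assoc, ← map_add]
    congr 2
    change (f.linear x + f 0, y + 0) = (f x, y)
    rw [add_zero, ← hfx]
  rw [key]

/-- Linear preimages (special case of `HasExpPsdLift.comap`). [folklore] -/
theorem HasExpPsdLift.comap_linearMap {E' : Type*} [AddCommGroup E'] [Module ℝ E'] {C : Set E}
    {k m : ℕ} (h : HasExpPsdLift C k m) (f : E' →ₗ[ℝ] E) : HasExpPsdLift (f ⁻¹' C) k m :=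
  h.comap f.toAffineMap

/-- Images under linear equivalences (special case of `HasExpPsdLift.comap`). [folklore] -/
theorem HasExpPsdLift.image_linearEquiv {E' : Type*} [AddCommGroup E'] [Module ℝ E'] {C : Set E}
    {k m : ℕ} (h : HasExpPsdLift C k m) (f : E ≃ₗ[ℝ] E') : HasExpPsdLift (f '' C) k m := by
  have hC : f '' C = (f.symm : E' → E) ⁻¹' C := by
    ext z
    simp only [Set.mem_image, Set.mem_preimage]
    constructor
    · rintro ⟨x, hx, rfl⟩
      simpa using hx
    · intro hz
      exact ⟨f.symm z, hz, f.apply_symm_apply z⟩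
  rw [hC]
  exact h.comap_linearMap f.symm.toLinearMap

/-- The whole space has the empty lift (`k = m = 0`). [folklore] -/
theorem hasExpPsdLift_univ : HasExpPsdLift (Set.univ : Set E) 0 0 := by
  refine ⟨0, 0, 0, ?_⟩
  ext x
  simp only [Set.mem_univ, LinearMap.zero_apply, add_zero, Set.mem_setOf_eq, true_iff]
  exact ⟨0, zero_mem_expPsdCone 0 0⟩

/-- The empty set has a lift by one exponential cone (`(0, 0, -1) ∉ K_exp`). [folklore] -/
theorem hasExpPsdLift_empty : HasExpPsdLift (∅ : Set E) 1 0 := by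
  rw [hasExpPsdLift_zero_iff]
  refine ⟨0, 0, fun _ => (0, 0, -1), fun x => ?_⟩
  simp only [Set.mem_empty_iff_false, LinearMap.zero_apply, zero_add, false_iff, not_exists,
    not_forall]
  intro y
  refine ⟨0, ?_⟩
  rw [mem_expCone_zero_iff]
  norm_num

/-- **Half-spaces** `{x | ℓ x ≤ c}` have a lift by one exponential cone (the LP unit
`(0, s, s) ∈ K_exp ↔ 0 ≤ s` with `s = c - ℓ x`). [folklore] -/
theorem hasExpPsdLift_halfSpace (ℓ : E →ₗ[ℝ] ℝ) (c : ℝ) : HasExpPsdLift {x | ℓ x ≤ c} 1 0 := by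
  rw [hasExpPsdLift_zero_iff]
  refine ⟨0, LinearMap.pi fun _ => ((0 : E × (Fin 0 → ℝ) →ₗ[ℝ] ℝ).prod
      ((-(ℓ.comp (LinearMap.fst ℝ E _))).prod (-(ℓ.comp (LinearMap.fst ℝ E _))))),
    fun _ => (0, c, c), fun x => ?_⟩
  change ℓ x ≤ c ↔ ∃ _ : Fin 0 → ℝ, ∀ _ : Fin 1, ((0 : ℝ), -ℓ x, -ℓ x) + ((0 : ℝ), c, c) ∈ expCone
  simp only [Prod.mk_add_mk, add_zero, neg_add_eq_sub, mem_expCone_nonneg_iff, sub_nonneg,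
    forall_const, exists_const]

/-- **Hyperplanes** `{x | ℓ x = c}` have a lift by one exponential cone (the equation unit
`(0, s, 0) ∈ K_exp ↔ s = 0` with `s = c - ℓ x`). [folklore] -/
theorem hasExpPsdLift_hyperplane (ℓ : E →ₗ[ℝ] ℝ) (c : ℝ) : HasExpPsdLift {x | ℓ x = c} 1 0 := by
  rw [hasExpPsdLift_zero_iff]
  refine ⟨0, LinearMap.pi fun _ => ((0 : E × (Fin 0 → ℝ) →ₗ[ℝ] ℝ).prod
      ((-(ℓ.comp (LinearMap.fst ℝ E _))).prod 0)), fun _ => (0, c, 0), fun x => ?_⟩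
  change ℓ x = c ↔
    ∃ _ : Fin 0 → ℝ, ∀ _ : Fin 1, ((0 : ℝ), -ℓ x, (0 : ℝ)) + ((0 : ℝ), c, (0 : ℝ)) ∈ expCone
  simp only [Prod.mk_add_mk, add_zero, neg_add_eq_sub, mem_expCone_eq_iff, sub_eq_zero,
    forall_const, exists_const]
  exact eq_comm

/-! ## Free energies -/

/-- The **free energy** (log-partition function, log-Laplace transform of the coefficient
measure) of a real multivariate polynomial `f` in logarithmic coordinates:
`freeEnergy f u = log f(e^{u})`, `(e^u)_i = exp (u i)`.  For `f ≠ 0` with nonnegative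
coefficients `f(e^u) > 0` and this is the convex function `u ↦ log Σ_e c_e exp⟨e, u⟩`
(geometric programming); for other `f` the value inherits Mathlib's junk `Real.log x` for
`x ≤ 0`. [folklore] -/
def freeEnergy {σ : Type*} (f : MvPolynomial σ ℝ) (u : σ → ℝ) : ℝ :=
  Real.log (MvPolynomial.eval (fun i => Real.exp (u i)) f)

/-- The epigraph `{(u, t) | log f(e^u) ≤ t}` of the free energy of `f`. [folklore] -/
def freeEnergyEpigraph {σ : Type*} (f : MvPolynomial σ ℝ) : Set ((σ → ℝ) × ℝ) :=
  {q | freeEnergy f q.1 ≤ q.2}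

/-- Unfolding of `freeEnergy`. [folklore] -/
theorem freeEnergy_def {σ : Type*} (f : MvPolynomial σ ℝ) (u : σ → ℝ) :
    freeEnergy f u = Real.log (MvPolynomial.eval (fun i => Real.exp (u i)) f) :=
  rfl

/-- Membership in the free-energy epigraph, in the literal form inlined in route
`FreeEnergyLift`. [folklore] -/
theorem mem_freeEnergyEpigraph_iff {σ : Type*} (f : MvPolynomial σ ℝ) (u : σ → ℝ) (t : ℝ) :
    (u, t) ∈ freeEnergyEpigraph f ↔
      Real.log (MvPolynomial.eval (fun i => Real.exp (u i)) f) ≤ t :=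
  Iff.rfl

/-- A free-energy epigraph has an exp+psd lift of size profile `(k, m)` iff lift data of the
literal shape used by route `FreeEnergyLift` exist. [folklore] -/
theorem hasExpPsdLift_freeEnergyEpigraph_iff {σ : Type*} (f : MvPolynomial σ ℝ) (k m : ℕ) :
    HasExpPsdLift (freeEnergyEpigraph f) k m ↔
      ∃ (p : ℕ) (A : ((σ → ℝ) × ℝ) × (Fin p → ℝ) →ₗ[ℝ] LiftSpace k m) (b : LiftSpace k m),
        ∀ (u : σ → ℝ) (t : ℝ),
          Real.log (MvPolynomial.eval (fun i => Real.exp (u i)) f) ≤ t ↔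
            ∃ y : Fin p → ℝ,
              (∀ i, (A ((u, t), y) + b).1 i ∈ expCone) ∧ (A ((u, t), y) + b).2.PosSemidef := by
  rw [hasExpPsdLift_iff_prod]
  rfl

end Literature.Analysis.Convex
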